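import Mathlib
import Summits.Ventures.HodgeRepro.Tier4.Common.AdelicDefs
import Summits.Ventures.HodgeRepro.Tier4.Line1.AdeleCocompact
import Summits.Ventures.HodgeRepro.Tier4.Line1.CocompactAssembly
import Summits.Ventures.HodgeRepro.Tier4.Line1.HaarCharInvolution
import Summits.Ventures.HodgeRepro.Tier4.Line1.AdelicBlichfeldtPi
import Summits.Ventures.HodgeRepro.Tier4.Line1.NormOneTorusAlgebra

/-!
# Tier4/Line1/NormOneTorus — hstab rung (ii): the norm-one torus of `k(√−d)` is cocompact in `𝔸_k²` (PROVED)

Blind re-derivation cell `pub-hodge-repro`, Tier 4 (README §9–§10), seat t4-L1-p5 (prover, LINE L1, gen 2).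
The cut of the cocompactness wall R-c (`proofs/t4/L1/I1-c-CENSUS.md` §5–§7) ends in `hstab`, the cocompactness of the
stabiliser of a non-zero rational vector; t4-L1-p3's rung (i) (`stab_line_scalar`) identifies that stabiliser with the
norm-one torus `T¹ = {(x, y) ∈ 𝔸_k² : x² + d y² = 1}` of the quadratic algebra `k(√−d) ⊗ 𝔸_k`, and rung (ii) — the
DECLARED RESIDUAL of R-c (lead g385 R-II, S12860) — is the statement `NormOneTorusCocompact k d` below:
`T¹ = T¹(k) · C` for a compact `C`.  This module PROVES it, from what the tree has, by the Mostow–Tamagawa argument in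
rank one (no Witt step): adelic Blichfeldt on `𝔸_k²` (`AdelicBlichfeldtPi`, unconditional since «`𝔸_k/k` is compact»
is in the tree), the finiteness of `k ∩ (compact)` (`PrincipalDiscrete`), and the one new input — multiplication by a
norm-one `t` PRESERVES every Haar measure on `𝔸_k²`: it is conjugate, by the involution `(x, y) ↦ (x, −y)`, to
multiplication by `t̄ = t⁻¹`, so its Haar character squares to `1` (`HaarCharInvolution`).  No place decomposition of
`𝔸_k`, no generation of `SL₂(𝔸_k)` by elementary matrices, no Fujisaki lemma for `E′` as a number field.

Nothing here says anything about the status of the Hodge conjecture for CM abelian varieties, which is NOT proved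
(HC_CM is NOT proved by anyone in this repository).
-/

set_option autoImplicit false

noncomputable section

namespace Summit.Ventures.HodgeRepro.Tier4.Line1

open NumberField MeasureTheory Topology Set Common
open scoped ENNReal Pointwise

section MoreAlgebra

variable {R : Type*} [CommRing R]

/-- the multiplication is additive in the left factor: differences -/
theorem sub_qmul (d : R) (z z' w : Fin 2 → R) : qmul d (z - z') w = qmul d z w - qmul d z' w := by
  funext i
  fin_cases i <;> simp <;> ring

end MoreAlgebra

section Torus

variable (k : Type) [Field k] [NumberField k]

/-- a rational pair `x ∈ k²`, read adelically in `𝔸_k²` -/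
def qrat (x : Fin 2 → k) : Fin 2 → Ad k := fun i => algebraMap k (Ad k) (x i)

/-- **hstab rung (ii), TYPED** — the DECLARED RESIDUAL of the R-c cut (lead g385 R-II S12860; t4-L1-p3 S12862: «the
residual wall (ii) reads: `{(x, y) ∈ 𝔸_k² : x² + d y² = 1}` modulo `{(x, y) ∈ k²}` is compact»).  On pairs, with the
multiplication `qmul d` of `k(√−d) ⊗ 𝔸_k` and the norm form `qnorm d = x² + d y²`: there is a compact `C ⊆ 𝔸_k²` such
that every norm-one adelic `t` is `γ · c` with `γ ∈ k²` of norm `1` and `c ∈ C` of norm `1` (so `T¹(𝔸_k) = T¹(k) · C`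
with `C ∩ T¹(𝔸_k)` compact in the subspace topology of `𝔸_k²`, which on `T¹` is the group topology since `t⁻¹ = t̄`). -/
def NormOneTorusCocompact (d : k) : Prop :=
  ∃ C : Set (Fin 2 → Ad k), IsCompact C ∧ ∀ t : Fin 2 → Ad k, qnorm (algebraMap k (Ad k) d) t = 1 →
    ∃ γ : Fin 2 → k, qnorm d γ = 1 ∧ ∃ c ∈ C, qnorm (algebraMap k (Ad k) d) c = 1 ∧
      t = qmul (algebraMap k (Ad k) d) (qrat k γ) c

variable {k}

/-- the rational embedding is multiplicative -/
theorem qrat_qmul (d : k) (x y : Fin 2 → k) :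
    qrat k (qmul d x y) = qmul (algebraMap k (Ad k) d) (qrat k x) (qrat k y) :=
  qmul_map (algebraMap k (Ad k)) d x y

/-- the rational embedding commutes with conjugation -/
theorem qrat_qconj (x : Fin 2 → k) : qrat k (qconj x) = qconj (qrat k x) :=
  qconj_map (algebraMap k (Ad k)) x

/-- the norm form of a rational pair, read adelically -/
theorem qnorm_qrat (d : k) (x : Fin 2 → k) :
    qnorm (algebraMap k (Ad k) d) (qrat k x) = algebraMap k (Ad k) (qnorm d x) :=
  (qnorm_map (algebraMap k (Ad k)) d x).symm

/-- the rational embedding of the unit -/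
theorem qrat_qone : qrat k (qone : Fin 2 → k) = qone := by
  funext i
  fin_cases i <;> simp [qrat]

/-- the conjugation `(x, y) ↦ (x, −y)` as a continuous additive automorphism of `𝔸_k²` (an involution) -/
def qconjEquiv : (Fin 2 → Ad k) ≃ₜ+ (Fin 2 → Ad k) where
  toFun := qconj
  invFun := qconj
  left_inv := qconj_qconj
  right_inv := qconj_qconj
  map_add' := qconj_add
  continuous_toFun := continuous_qconj
  continuous_invFun := continuous_qconj

/-- multiplication by a norm-one `t` as a continuous additive automorphism of `𝔸_k²` (inverse: multiplication by
`t̄`) -/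
def qmulEquiv (d : k) (t : Fin 2 → Ad k) (ht : qnorm (algebraMap k (Ad k) d) t = 1) :
    (Fin 2 → Ad k) ≃ₜ+ (Fin 2 → Ad k) where
  toFun z := qmul (algebraMap k (Ad k) d) z t
  invFun z := qmul (algebraMap k (Ad k) d) z (qconj t)
  left_inv z := by
    show qmul (algebraMap k (Ad k) d) (qmul (algebraMap k (Ad k) d) z t) (qconj t) = z
    rw [qmul_assoc, qmul_qconj_self_of_qnorm_eq_one _ ht, qmul_qone]
  right_inv z := by
    show qmul (algebraMap k (Ad k) d) (qmul (algebraMap k (Ad k) d) z (qconj t)) t = z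
    rw [qmul_assoc, qmul_comm _ (qconj t) t, qmul_qconj_self_of_qnorm_eq_one _ ht, qmul_qone]
  map_add' z w := add_qmul _ z w t
  continuous_toFun := continuous_qmul_right _ t
  continuous_invFun := continuous_qmul_right _ (qconj t)

/-- **The modulus of a norm-one element is `1`**: multiplication by `t̄ = t⁻¹` is conjugate to multiplication by `t`
under the involution `qconjEquiv`, so the Haar character of multiplication by `t` squares to `1`. -/
theorem addEquivAddHaarChar_qmulEquiv [MeasurableSpace (Fin 2 → Ad k)] [BorelSpace (Fin 2 → Ad k)]
    [LocallyCompactSpace (Fin 2 → Ad k)] (d : k) (t : Fin 2 → Ad k)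
    (ht : qnorm (algebraMap k (Ad k) d) t = 1) :
    addEquivAddHaarChar (qmulEquiv d t ht) = 1 := by
  have ht' : qnorm (algebraMap k (Ad k) d) (qconj t) = 1 := by
    rw [qnorm_qconj]
    exact ht
  refine addEquivAddHaarChar_eq_one_of_conj_inv (qmulEquiv d t ht) (qmulEquiv d (qconj t) ht')
    qconjEquiv (fun z => qconj_qconj z) (fun z => ?_) (fun z => ?_)
  · show qmul (algebraMap k (Ad k) d) z (qconj t) =
      qconj (qmul (algebraMap k (Ad k) d) (qconj z) t)
    rw [qconj_qmul, qconj_qconj]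
  · show qmul (algebraMap k (Ad k) d) (qmul (algebraMap k (Ad k) d) z t) (qconj t) = z
    rw [qmul_assoc, qmul_qconj_self_of_qnorm_eq_one _ ht, qmul_qone]

/-- **Multiplication by a norm-one element preserves every Haar measure on `𝔸_k²`** (the rank-one case of the
modulus rung C5, proved without any place decomposition). -/
theorem measure_image_qmul_eq [MeasurableSpace (Fin 2 → Ad k)] [BorelSpace (Fin 2 → Ad k)]
    (μ : Measure (Fin 2 → Ad k)) [μ.IsAddHaarMeasure] (d : k) (t : Fin 2 → Ad k)
    (ht : qnorm (algebraMap k (Ad k) d) t = 1) (S : Set (Fin 2 → Ad k)) :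
    μ ((fun z => qmul (algebraMap k (Ad k) d) z t) '' S) = μ S := by
  haveI := t2Space_adeleRing k
  haveI := locallyCompactSpace_adeleRing k
  haveI := secondCountable_adeleRing k
  haveI : LocallyCompactSpace (Fin 2 → Ad k) := Pi.locallyCompactSpace_of_finite
  exact measure_image_eq_of_addEquivAddHaarChar_eq_one μ (qmulEquiv d t ht)
    (addEquivAddHaarChar_qmulEquiv d t ht) S

/-- **hstab rung (ii) HOLDS — the norm-one torus of `k(√−d)` is cocompact in `𝔸_k²`** (Mostow–Tamagawa in rank one):
for a norm-one adelic `t`, Blichfeldt on the translate `S₀ t̄` of a compact set of large Haar measure (the modulus of `t̄`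
is `1`) gives a non-zero rational `x` with `x t ∈ K₀ := S₀ − S₀`; the rational norm `N(x) = N(x t)` takes finitely many
values on the compact `K₀` and is non-zero (anisotropy: `−d` is not a square); a representative `x_n` of each value
and `γ := x x_n⁻¹ ∈ k²` of norm `1` give `γ t = (x t) x_n⁻¹ ∈ K₀ x_n⁻¹`, a compact set depending only on `n`; so
`t = γ̄ · (γ t)` with `γ̄ ∈ T¹(k)` and `γ t` in the compact `C := (⋃_n K₀ x_n⁻¹) ∩ T¹`. -/
theorem normOneTorusCocompact (d : k) (hd : ¬ IsSquare (-d)) : NormOneTorusCocompact k d := by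
  classical
  haveI := t2Space_adeleRing k
  haveI := locallyCompactSpace_adeleRing k
  haveI := secondCountable_adeleRing k
  haveI : LocallyCompactSpace (Fin 2 → Ad k) := Pi.locallyCompactSpace_of_finite
  haveI : NoncompactSpace (Fin 2 → Ad k) := noncompactSpace_adelePi k (Fin 2)
  letI : MeasurableSpace (Fin 2 → Ad k) := borel _
  haveI : BorelSpace (Fin 2 → Ad k) := ⟨rfl⟩
  let μ : Measure (Fin 2 → Ad k) := Measure.addHaar
  -- Blichfeldt and a compact set of measure `> c₀`
  obtain ⟨c₀, hc₀, hB⟩ := exists_ne_zero_rational_mem_sub_pi k (Fin 2) μ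
  have huniv : μ Set.univ = ∞ := measure_univ_of_isAddLeftInvariant μ
  obtain ⟨S₀, hS₀, hS₀μ⟩ := exists_isCompact_lt_measure_of_measure_univ_eq_top μ huniv hc₀
  set K₀ : Set (Fin 2 → Ad k) :=
    (fun p : (Fin 2 → Ad k) × (Fin 2 → Ad k) => p.1 - p.2) '' (S₀ ×ˢ S₀) with hK₀def
  have hK₀ : IsCompact K₀ := (hS₀.prod hS₀).image continuous_sub
  -- the norm map takes finitely many rational values on `K₀`
  let N : (Fin 2 → Ad k) → Ad k := fun z => qnorm (algebraMap k (Ad k) d) z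
  have hN : Continuous N := continuous_qnorm (algebraMap k (Ad k) d)
  have hV : {n : k | algebraMap k (Ad k) n ∈ N '' K₀}.Finite :=
    finite_principal_inter_of_isCompact k (hK₀.image hN)
  -- representatives of each rational value, and the compact pieces `K₀ x_n⁻¹`
  let Rep : k → Set (Fin 2 → k) := fun n => {x | x ≠ 0 ∧ qnorm d x = n}
  let Kn : k → Set (Fin 2 → Ad k) := fun n =>
    if h : (Rep n).Nonempty then
      (fun z => qmul (algebraMap k (Ad k) d) z (qrat k (qinv d (Classical.choose h)))) '' K₀
    else ∅
  have hKn : ∀ n, IsCompact (Kn n) := by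
    intro n
    simp only [Kn]
    split_ifs with h
    · exact hK₀.image (continuous_qmul_right _ _)
    · exact isCompact_empty
  refine ⟨(⋃ n ∈ {n : k | algebraMap k (Ad k) n ∈ N '' K₀}, Kn n) ∩
      {z | qnorm (algebraMap k (Ad k) d) z = 1},
    (hV.isCompact_biUnion fun n _ => hKn n).inter_right
      (isClosed_eq (continuous_qnorm _) continuous_const), ?_⟩
  intro t ht
  have ht' : qnorm (algebraMap k (Ad k) d) (qconj t) = 1 := by
    rw [qnorm_qconj]
    exact ht
  -- Blichfeldt on `S := S₀ t̄ = {z : z t ∈ S₀}`, of measure `μ S₀ > c₀`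
  set S : Set (Fin 2 → Ad k) := (fun z => qmul (algebraMap k (Ad k) d) z t) ⁻¹' S₀ with hSdef
  have hSeq : S = (fun z => qmul (algebraMap k (Ad k) d) z (qconj t)) '' S₀ := by
    ext z
    simp only [S, Set.mem_preimage, Set.mem_image]
    constructor
    · intro hz
      refine ⟨qmul (algebraMap k (Ad k) d) z t, hz, ?_⟩
      rw [qmul_assoc, qmul_qconj_self_of_qnorm_eq_one _ ht, qmul_qone]
    · rintro ⟨y, hy, rfl⟩
      rw [qmul_assoc, qmul_comm _ (qconj t) t, qmul_qconj_self_of_qnorm_eq_one _ ht, qmul_qone]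
      exact hy
  have hSmeas : MeasurableSet S :=
    (hS₀.isClosed.preimage (continuous_qmul_right _ t)).measurableSet
  have hSμ : c₀ < μ S := by
    rw [hSeq, measure_image_qmul_eq μ d (qconj t) ht']
    exact hS₀μ
  obtain ⟨x, hx0, s, hs, s', hs', hss'⟩ := hB S hSmeas hSμ
  -- `x t ∈ K₀`
  have hxt : qmul (algebraMap k (Ad k) d) (qrat k x) t ∈ K₀ := by
    refine ⟨(qmul (algebraMap k (Ad k) d) s t, qmul (algebraMap k (Ad k) d) s' t), ⟨hs, hs'⟩, ?_⟩
    show qmul (algebraMap k (Ad k) d) s t - qmul (algebraMap k (Ad k) d) s' t =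
      qmul (algebraMap k (Ad k) d) (qrat k x) t
    rw [← sub_qmul, hss']
    rfl
  -- the rational norm `n := N(x)` is non-zero and among the finitely many values on `K₀`
  have hn0 : qnorm d x ≠ 0 := qnorm_ne_zero_of_not_isSquare hd hx0
  have hnN : algebraMap k (Ad k) (qnorm d x) = N (qmul (algebraMap k (Ad k) d) (qrat k x) t) := by
    simp only [N]
    rw [qnorm_qmul, ht, mul_one, qnorm_qrat]
  have hnV : qnorm d x ∈ {n : k | algebraMap k (Ad k) n ∈ N '' K₀} := ⟨_, hxt, hnN.symm⟩
  have hrep : (Rep (qnorm d x)).Nonempty := ⟨x, hx0, rfl⟩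
  have hxn : Classical.choose hrep ∈ Rep (qnorm d x) := Classical.choose_spec hrep
  have hxnN : qnorm d (Classical.choose hrep) ≠ 0 := by
    rw [hxn.2]
    exact hn0
  -- `γ := x x_n⁻¹ ∈ k²` has norm `1`
  have hγ : qnorm d (qmul d x (qinv d (Classical.choose hrep))) = 1 := by
    rw [qnorm_qmul, qnorm_qinv d hxnN, hxn.2]
    exact mul_inv_cancel₀ hn0
  refine ⟨qconj (qmul d x (qinv d (Classical.choose hrep))), ?_,
    qmul (algebraMap k (Ad k) d) (qrat k (qmul d x (qinv d (Classical.choose hrep)))) t,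
    ⟨?_, ?_⟩, ?_, ?_⟩
  · rw [qnorm_qconj]
    exact hγ
  · -- `γ t = (x t) x_n⁻¹ ∈ K₀ x_n⁻¹`
    refine Set.mem_biUnion hnV ?_
    simp only [Kn, dif_pos hrep]
    refine ⟨qmul (algebraMap k (Ad k) d) (qrat k x) t, hxt, ?_⟩
    show qmul (algebraMap k (Ad k) d) (qmul (algebraMap k (Ad k) d) (qrat k x) t)
      (qrat k (qinv d (Classical.choose hrep))) = _
    rw [qmul_assoc, qmul_comm _ t (qrat k (qinv d (Classical.choose hrep))), ← qmul_assoc,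
      ← qrat_qmul]
  · show qnorm (algebraMap k (Ad k) d)
      (qmul (algebraMap k (Ad k) d) (qrat k (qmul d x (qinv d (Classical.choose hrep)))) t) = 1
    rw [qnorm_qmul, ht, mul_one, qnorm_qrat, hγ, map_one]
  · rw [qnorm_qmul, ht, mul_one, qnorm_qrat, hγ, map_one]
  · -- `t = γ̄ (γ t)`
    rw [← qmul_assoc, ← qrat_qmul, qmul_comm d (qconj _) _, qmul_qconj_self_of_qnorm_eq_one d hγ,
      qrat_qone, qone_qmul]

end Torus

end Summit.Ventures.HodgeRepro.Tier4.Line1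

end
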